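import Literature.AlgebraicGeometry.HodgeTheory.HodgeModelExistenceDischarge
import Literature.NumberTheory.Transcendental.DeRhamTheoremProofs
import HarnessLib

/-!
# The real form of de Rham's theorem with complex coefficients holds (discharge of (3ℝ)), and
# real Hodge models from the Hodge decomposition alone

Family `hodge`, layer `Literature/AlgebraicGeometry/HodgeTheory`. Leaf companion of
`ComplexConjugationProofs` (the named fact (3ℝ) `exists_isReal_complexDeRhamIsoFamily E`: a
natural AND real complex de Rham isomorphism family `H^k_dR(M; ℂ) ≃ₗ[ℂ] Hᵏ(M; ℂ)` over the
Hausdorff σ-compact real-`C^∞` manifolds charted on the finite-dimensional complex normed space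
`E`, and the assembly `exists_isReal_hodgeModel_of` of the named fact `exists_isReal_hodgeModel`
of `ComplexConjugation` from (3ℝ), (4a), (4b)), of `ComplexifiedDeRhamFamily` (PROVED: the
complexification `e ⊗ ℂ` of every real de Rham isomorphism family is real, and natural when `e`
is) and of `HodgeModelExistenceDischarge` (the assemblies with (4a) discharged). It cannot live in
`ComplexConjugationProofs` itself: the proof imports `Transcendental/DeRhamTheoremProofs`, which
imports `ComplexifiedDeRhamFamily`, which imports `ComplexConjugationProofs`.

Since those files were written, **de Rham's theorem has become a theorem of the tree**:
`Literature.NumberTheory.Transcendental.integrationDeRhamIsoFamily E` (`DeRhamTheoremProofs`; de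
Rham (1931), Bredon (1993) Thm. V.9.5, Lee (2013) Thm. 18.14, Warner (1983) 5.36–5.38) is the
real de Rham isomorphism family `[α] ↦ [σ ↦ ∫_σ α]` over the Hausdorff σ-compact `C^∞` manifolds
charted on a finite-dimensional real normed space, natural for `C^∞` maps
(`integrationDeRhamIsoFamily_isNatural`) and normalised. PROVED here (theorems only; no
definition, no named fact — D-0026):

* `exists_isReal_complexDeRhamIsoFamily_holds` — **discharge of the named fact (3ℝ)**
  `exists_isReal_complexDeRhamIsoFamily E` for every finite-dimensional complex normed space `E`
  (all universes): the complexification `(integrationDeRhamIsoFamily E) ⊗ ℂ`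
  (`DeRhamIsoFamily.complexify`) is natural (`DeRhamIsoFamily.complexify_isNatural`) and real
  (`DeRhamIsoFamily.complexify_isReal`). This is exactly the printed statement "complex
  conjugation acts naturally on `H^k(X, ℂ) = H^k(X, ℝ) ⊗ ℂ`" (Voisin (2002), Cor. 6.12) for the
  comparison "induced by integration of forms over differentiable singular simplices,
  `ω ↦ (φ ↦ ∫_Δ φ^* ω)`" (Voisin (2002), Thm. 4.47 with Rem. 4.48).
* `exists_isNatural_deRhamIsoFamily_complexModel` — the natural real family for a complex model
  space with its underlying real structure (the hypothesis (3ₙ) of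
  `HodgeModelExistenceDischarge`, discharged).
* `exists_isReal_hodgeModel_of_hodgeDecomposition` — **the named fact `exists_isReal_hodgeModel`
  (every smooth projective `X/ℂ` has a REAL Hodge model) now follows from (4b) the Hodge
  decomposition of compact Kähler manifolds (`Motives.isInternal_hodgePQ`, Voisin (2002) §6.1.3
  Prop. 6.11) ALONE**: (3ℝ) is `exists_isReal_complexDeRhamIsoFamily_holds` and (4a) is the
  theorem `Motives.isKaehlerManifold_of_isAnalytification_of_isClosedImmersion_holds`
  (`GAGAKaehlerImmersionProofs`), fed to `exists_isReal_hodgeModel_of`.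
  (The analogous reduction of the weaker `nonempty_hodgeModel n X` is already the tree's
  `nonempty_hodgeModel_of_hodgeDecomposition`, file `MiddleDimensionReductionOfHodgeDecomposition`.)

Hence the trust base of `exists_isReal_hodgeModel` is exactly {`isInternal_hodgePQ`} (the
harmonic/elliptic theory of compact manifolds, Warner Thms. 6.5/6.6, reduced in
`Motives/HodgeDecompositionIsInternal*Proofs`), like that of `nonempty_hodgeModel`; its closed
discharge is `exists_isReal_hodgeModel_of_hodgeDecomposition ‹4b›` the moment
`isInternal_hodgePQ_holds` lands.

## References

* C. Voisin, *Hodge Theory and Complex Algebraic Geometry I* (2002), §4.3.2 (Thm. 4.47,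
  Rem. 4.48), §6.1.3 (Prop. 6.11, Cor. 6.12). [VoisinHodgeI2002]
* G. E. Bredon, *Topology and Geometry*, GTM 139 (1993), Thm. V.9.5. [Bredon1993]
* J.-P. Serre, *Géométrie algébrique et géométrie analytique*, Ann. Inst. Fourier 6 (1956), §2
  n°5 Prop. 2, n°7 Prop. 6. [SerreGAGA1956]
* G. de Rham, *Sur l'analysis situs des variétés à n dimensions* (1931).
-/

noncomputable section

open scoped Manifold ContDiff

universe u

namespace Literature.AlgebraicGeometry.HodgeTheory

section HodgeTheory

open Literature.NumberTheory.Transcendental (DeRhamIsoFamily integrationDeRhamIsoFamily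
  integrationDeRhamIsoFamily_isNatural exists_isNatural_deRhamIsoFamily)

/-! ### Discharge of (3ℝ) -/

/-- **de Rham's theorem with complex coefficients, real form — discharge of the named fact
`exists_isReal_complexDeRhamIsoFamily`.** For every finite-dimensional complex normed space `E`
there is a complex de Rham isomorphism family `H^k_dR(M; ℂ) ≃ₗ[ℂ] Hᵏ(M; ℂ)` over the Hausdorff
σ-compact real-`C^∞` manifolds charted on `E` which is natural for `C^∞` maps and real (commutes
with the two complex conjugations): the complexification `e ⊗ ℂ`,
`c ↦ e(re c) ⊗ 1 + i • e(im c) ⊗ 1`, of the integration family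
`e = integrationDeRhamIsoFamily E`, `[α] ↦ [σ ↦ ∫_σ α]` (de Rham's theorem, PROVED in
`Transcendental/DeRhamTheoremProofs`), natural because `e` is
(`DeRhamIsoFamily.complexify_isNatural`, `integrationDeRhamIsoFamily_isNatural`) and real as the
complexification of any real family (`DeRhamIsoFamily.complexify_isReal`) — "where complex
conjugation acts naturally on `H^k(X, ℂ) = H^k(X, ℝ) ⊗ ℂ`".
[cite: VoisinHodgeI2002, §4.3.2 Thm. 4.47, Rem. 4.48 and §6.1.3 Cor. 6.12]
[cite: Bredon1993, Thm. V.9.5] -/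
theorem exists_isReal_complexDeRhamIsoFamily_holds (E : Type u) [NormedAddCommGroup E]
    [NormedSpace ℂ E] [FiniteDimensional ℂ E] : exists_isReal_complexDeRhamIsoFamily E := by
  haveI : FiniteDimensional ℝ E := FiniteDimensional.complexToReal E
  exact ⟨(integrationDeRhamIsoFamily E).complexify,
    DeRhamIsoFamily.complexify_isNatural integrationDeRhamIsoFamily_isNatural,
    (integrationDeRhamIsoFamily E).complexify_isReal⟩

/-- **A natural real de Rham isomorphism family for a complex model space** with its underlying
real structure (the hypothesis (3ₙ) of `nonempty_hodgeModel_of_isNatural_of_hodgeDecomposition`,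
discharged): the integration family. [cite: Bredon1993, Thm. V.9.5] -/
theorem exists_isNatural_deRhamIsoFamily_complexModel (E : Type u) [NormedAddCommGroup E]
    [NormedSpace ℂ E] [FiniteDimensional ℂ E] :
    ∃ e : DeRhamIsoFamily 𝓘(ℝ, E), e.IsNatural :=
  haveI : FiniteDimensional ℝ E := FiniteDimensional.complexToReal E
  let ⟨e, he, _⟩ := exists_isNatural_deRhamIsoFamily E
  ⟨e, he⟩

/-! ### Real Hodge models from the Hodge decomposition alone -/

/-- **The named fact `exists_isReal_hodgeModel` follows from the Hodge decomposition of compact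
Kähler manifolds alone.** If (4b) `Motives.isInternal_hodgePQ` holds for every
finite-dimensional complex model space and every manifold charted on it (Voisin (2002), §6.1.3
Prop. 6.11), then every smooth projective `X/ℂ` of dimension `n` has a REAL Hodge model: the
assembly `exists_isReal_hodgeModel_of` (Serre's analytification, GAGA §2 n°5 Prop. 2 and n°7
Prop. 6, proved upstream) fed with (3ℝ) `exists_isReal_complexDeRhamIsoFamily_holds (Fin n → ℂ)`
and (4a) the theorem `Motives.isKaehlerManifold_of_isAnalytification_of_isClosedImmersion_holds`
(the pulled-back Fubini–Study metric along a projective embedding, Voisin (2002) §3.3.2).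
The closed discharge `exists_isReal_hodgeModel_holds` is this theorem fed
`Motives.isInternal_hodgePQ_holds` when that lands.
[cite: SerreGAGA1956, §2 n°5 Prop. 2 and n°7 Prop. 6]
[cite: VoisinHodgeI2002, §3.3.2 p. 77, §4.3.2 Rem. 4.48, §6.1.3 Prop. 6.11 and Cor. 6.12] -/
theorem exists_isReal_hodgeModel_of_hodgeDecomposition
    (h4b : ∀ (E : Type) [NormedAddCommGroup E] [NormedSpace ℂ E] [FiniteDimensional ℂ E]
      (M : Type) [TopologicalSpace M] [ChartedSpace E M] [IsManifold 𝓘(ℝ, E) ∞ M],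
      Motives.isInternal_hodgePQ (E := E) (M := M)) :
    exists_isReal_hodgeModel :=
  exists_isReal_hodgeModel_of (fun n ↦ exists_isReal_complexDeRhamIsoFamily_holds (Fin n → ℂ))
    (fun _ _ _ _ _ _ _ _ _ _ ↦
      Motives.isKaehlerManifold_of_isAnalytification_of_isClosedImmersion_holds)
    h4b

/-- Consistency with `HodgeModelExistenceDischarge`: its natural-family assembly
`exists_isReal_hodgeModel_of_isNatural_of_hodgeDecomposition`, fed with the integration families
(`exists_isNatural_deRhamIsoFamily_complexModel`), gives the same reduction.
[cite: VoisinHodgeI2002, §6.1.3 Prop. 6.11 and Cor. 6.12] -/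
theorem exists_isReal_hodgeModel_of_hodgeDecomposition'
    (h4b : ∀ (E : Type) [NormedAddCommGroup E] [NormedSpace ℂ E] [FiniteDimensional ℂ E]
      (M : Type) [TopologicalSpace M] [ChartedSpace E M] [IsManifold 𝓘(ℝ, E) ∞ M],
      Motives.isInternal_hodgePQ (E := E) (M := M)) :
    exists_isReal_hodgeModel :=
  exists_isReal_hodgeModel_of_isNatural_of_hodgeDecomposition
    (fun E _ _ _ ↦ exists_isNatural_deRhamIsoFamily_complexModel E) h4b

end HodgeTheory

end Literature.AlgebraicGeometry.HodgeTheory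

end
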